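import Summits.Ventures.PercRepro.S1TriangleSeven

/-!
# PercRepro — nullity `8`: at most fifteen triangles, and the core forms (p2, gen 17; part 2 of S1TriangleSeven)

The second half of S1TriangleSeven, split at the 400-line cap (proof text unchanged):

* **`ncard_triangles_le_fifteen_of_nullity_eight`** — `s₃ ≤ 15` at nullity `8` (one recursion step from `12`);
* the core forms `core_ncard_triangles_le_twelve_of_nullity_seven`, `core_ncard_triangles_le_fifteen_of_nullity_eight`.
AUTHOR p2 g17; split by p3 g22 at the 400-line cap (RULING (um)(64)) — this file = l.379–493 of p2's 494-line
S1TriangleSeven.lean (sha256 0ba1fabefeb8c514366e6396660bbe57236e676c068be0d487c99516f0ca4c88) under a new header, bodies byte-identical.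
Axioms: standard.
-/

open scoped Matroid

namespace PercRepro

namespace S1

open Set

variable {α : Type}

/-- **Nullity `8`: at most fifteen triangles** under (C1), (C2), (C3) (one recursion step from `12`). -/
theorem ncard_triangles_le_fifteen_of_nullity_eight (M : Matroid α) [M.Finite]
    (hC1 : ∀ L ⊆ M.E, M.eRk L = 2 → L.ncard ≤ 3) (hC2 : ∀ P ⊆ M.E, M.eRk P ≤ 3 → P.ncard ≤ 6)
    (hC3 : ∀ X ⊆ M.E, M.eRk X ≤ 4 → X.ncard ≤ 10) (hd : M.E.encard = M.eRank + ((8 : ℕ) : ℕ∞)) :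
    (ThmN.triangles M).ncard ≤ 15 := by
  suffices H : ∀ n : ℕ, ∀ (M : Matroid α) [M.Finite], M.E.ncard = n →
      (∀ L ⊆ M.E, M.eRk L = 2 → L.ncard ≤ 3) → (∀ P ⊆ M.E, M.eRk P ≤ 3 → P.ncard ≤ 6) →
      (∀ X ⊆ M.E, M.eRk X ≤ 4 → X.ncard ≤ 10) →
      M.E.encard = M.eRank + ((8 : ℕ) : ℕ∞) → (ThmN.triangles M).ncard ≤ 15 from
    H _ M rfl hC1 hC2 hC3 hd
  intro n
  induction n using Nat.strong_induction_on with
  | _ n ih =>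
  intro M _ hn hC1 hC2 hC3 hd
  classical
  by_cases hcol : ∃ k ∈ M.E, M.IsColoop k
  · obtain ⟨k, hkE, hk⟩ := hcol
    have hlt : (M ＼ {k}).E.ncard < n := by
      rw [_root_.Matroid.delete_ground, ← hn]
      exact Set.ncard_sdiff_singleton_lt_of_mem hkE M.ground_finite
    have hC1' : ∀ L ⊆ (M ＼ {k}).E, (M ＼ {k}).eRk L = 2 → L.ncard ≤ 3 := by
      intro L hL hr
      rw [_root_.Matroid.delete_ground] at hL
      rw [delete_singleton_eRk_eq hL] at hr
      exact hC1 L (hL.trans Set.sdiff_subset) hr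
    have hC2' : ∀ P ⊆ (M ＼ {k}).E, (M ＼ {k}).eRk P ≤ 3 → P.ncard ≤ 6 := by
      intro P hP hr
      rw [_root_.Matroid.delete_ground] at hP
      rw [delete_singleton_eRk_eq hP] at hr
      exact hC2 P (hP.trans Set.sdiff_subset) hr
    have hC3' : ∀ X ⊆ (M ＼ {k}).E, (M ＼ {k}).eRk X ≤ 4 → X.ncard ≤ 10 := by
      intro X hX hr
      rw [_root_.Matroid.delete_ground] at hX
      rw [delete_singleton_eRk_eq hX] at hr
      exact hC3 X (hX.trans Set.sdiff_subset) hr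
    have hd' : (M ＼ {k}).E.encard = (M ＼ {k}).eRank + ((8 : ℕ) : ℕ∞) :=
      encard_delete_eq_of_isColoop M hk hd
    have := ih _ hlt (M ＼ {k}) rfl hC1' hC2' hC3' hd'
    rwa [triangles_delete_eq_of_isColoop M hk] at this
  have hcol' : ∀ x ∈ M.E, ¬ M.IsColoop x := fun x hx h => hcol ⟨x, hx, h⟩
  by_contra hgt
  have h16 : 16 ≤ (ThmN.triangles M).ncard := by omega
  have hSfin : (ThmN.triangles M).Finite :=
    M.ground_finite.finite_subsets.subset (fun C hC => hC.1.subset_ground)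
  obtain ⟨C, hC⟩ : (ThmN.triangles M).Nonempty := by
    rw [← Set.ncard_pos hSfin]; omega
  obtain ⟨r, hr, hnr, hr2⟩ := two_add_le_eRank_of_triangle M hd hC
  have hE2 : r ≠ 2 ∨ M.E.ncard ≤ 3 := by
    by_cases h : r = 2
    · refine Or.inr (hC1 M.E (subset_refl _) ?_)
      rw [← _root_.Matroid.eRank_def, hr, h]; norm_num
    · exact Or.inl h
  have hE3 : r ≠ 3 ∨ M.E.ncard ≤ 6 := by
    by_cases h : r = 3
    · refine Or.inr (hC2 M.E (subset_refl _) ?_)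
      rw [← _root_.Matroid.eRank_def, hr, h]; norm_num
    · exact Or.inl h
  have hE4 : r ≠ 4 ∨ M.E.ncard ≤ 10 := by
    by_cases h : r = 4
    · refine Or.inr (hC3 M.E (subset_refl _) ?_)
      rw [← _root_.Matroid.eRank_def, hr, h]; norm_num
    · exact Or.inl h
  have hm13 : 13 ≤ M.E.ncard := by omega
  -- a point of at most average degree, deleted: `s₃ ≤ ⌊3s₃/13⌋ + 12`
  obtain ⟨x, hxE, hx⟩ := exists_degree_mul_le M ⟨_, hC.1.subset_ground hC.1.nonempty.some_mem⟩
  obtain ⟨hd', hC1', hC2', hle⟩ :=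
    ncard_triangles_le_add_of_not_isColoop M hC1 hC2 (d := 7) hd hxE (hcol' x hxE)
  have hC3' : ∀ X ⊆ (M ＼ {x}).E, (M ＼ {x}).eRk X ≤ 4 → X.ncard ≤ 10 := by
    intro X hX hr
    rw [_root_.Matroid.delete_ground] at hX
    rw [delete_singleton_eRk_eq hX] at hr
    exact hC3 X (hX.trans Set.sdiff_subset) hr
  have h12 := ncard_triangles_le_twelve_of_nullity_seven (M ＼ {x}) hC1' hC2' hC3' hd'
  -- `t(x)·m ≤ 3·s₃`, `m ≥ 13`, `s₃ ≤ t(x) + 12`, `s₃ ≥ 16` ⇒ `t(x) ≥ 4` ⇒ `52 ≤ 4m ≤ 3·s₃`, and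
  -- `s₃ ≤ t(x) + 12` with `t(x)·13 ≤ 3·s₃ ≤ 3·t(x) + 36` ⇒ `t(x) ≤ 3` — contradiction
  have h1 : 4 ≤ (ThmN.trianglesThrough M x).ncard := by omega
  have h2 : (ThmN.trianglesThrough M x).ncard * 13 ≤ (ThmN.trianglesThrough M x).ncard * M.E.ncard :=
    Nat.mul_le_mul_left _ hm13
  omega

/-- **The cap `12` at nullity `7` on the `e`-free core.** -/
theorem core_ncard_triangles_le_twelve_of_nullity_seven (M : Matroid α) [M.Finite]
    (hfree : ∀ e ∈ M.E, ∃ A ⊆ M.E \ {e}, e ∉ M.closure A ∧ e ∉ M.closure ((M.E \ {e}) \ A))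
    (hd : M.E.encard = M.eRank + ((7 : ℕ) : ℕ∞)) :
    {C : Set α | M.IsCircuit C ∧ C.ncard = 3}.ncard ≤ 12 := by
  have hL : ∀ e ∈ M.E, ¬ M.IsLoop e := ThmN.not_isLoop_of_free M hfree
  have hline : ∀ L ⊆ M.E, M.eRk L = 2 → L.ncard ≤ 3 := by
    intro L hL' hr
    have := ThmN.ncard_add_one_le_two_pow_of_eRk_le M hL hfree 2 L hL' hr.le
    omega
  have hplane : ∀ P ⊆ M.E, M.eRk P ≤ 3 → P.ncard ≤ 6 := fun P hP hr =>
    ThmN.ncard_le_six_of_eRk_le_three_of_free M hfree hP hr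
  have hsolid : ∀ X ⊆ M.E, M.eRk X ≤ 4 → X.ncard ≤ 10 := fun X hX hr =>
    ThmN.ncard_le_ten_of_eRk_le_four_of_free M hfree hX hr
  exact ncard_triangles_le_twelve_of_nullity_seven M hline hplane hsolid hd

/-- **The cap `15` at nullity `8` on the `e`-free core** (the value the `q = 6` lane needs at `(35, 8)`). -/
theorem core_ncard_triangles_le_fifteen_of_nullity_eight (M : Matroid α) [M.Finite]
    (hfree : ∀ e ∈ M.E, ∃ A ⊆ M.E \ {e}, e ∉ M.closure A ∧ e ∉ M.closure ((M.E \ {e}) \ A))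
    (hd : M.E.encard = M.eRank + ((8 : ℕ) : ℕ∞)) :
    {C : Set α | M.IsCircuit C ∧ C.ncard = 3}.ncard ≤ 15 := by
  have hL : ∀ e ∈ M.E, ¬ M.IsLoop e := ThmN.not_isLoop_of_free M hfree
  have hline : ∀ L ⊆ M.E, M.eRk L = 2 → L.ncard ≤ 3 := by
    intro L hL' hr
    have := ThmN.ncard_add_one_le_two_pow_of_eRk_le M hL hfree 2 L hL' hr.le
    omega
  have hplane : ∀ P ⊆ M.E, M.eRk P ≤ 3 → P.ncard ≤ 6 := fun P hP hr =>
    ThmN.ncard_le_six_of_eRk_le_three_of_free M hfree hP hr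
  have hsolid : ∀ X ⊆ M.E, M.eRk X ≤ 4 → X.ncard ≤ 10 := fun X hX hr =>
    ThmN.ncard_le_ten_of_eRk_le_four_of_free M hfree hX hr
  exact ncard_triangles_le_fifteen_of_nullity_eight M hline hplane hsolid hd

end S1

end PercRepro
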